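import Summits.ResolutionOfSingularities.ResolutionOfSingularities.Theorems.JumpCutModel
import Summits.ResolutionOfSingularities.ResolutionOfSingularities.Theorems.NoJump
import HarnessLib

/-!
# JumpCut — NO FORCED WALK EVER JUMPS (decomp-res lens 3, generation 13; RESIDUAL MODE, host route MaxContactCut)

(decomp-res node N70 «NoJump ∥ JumpCut»: lens-3 g13 `JumpCut.lean` rev 2 sha256 0a503d388e12867c; CRITIC-LEDGER
row 89 CLEARED as
CONVERGENT INDEPENDENT PROOF + MAP delta (co-credit with lens-5 g14 `NoJump`, row 88, whose kernel proof of item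
31871 is the landed
`Theorems.NoJump`).)

[WRITER NOTE (decomp-res writer g5).  REBASED on `Theorems.NoJump` per critic row 89: the lens's second proofs of
the walk law and of
item 31871 (`walk_ord_lt` = `NoJump.order_lt_two_mul`, `shade_succ_le_shade`, `shade_antitone`, `not_jumpAt`,
`not_recurrentJumps`,
`shade_eventuallyStalls` = `NoJump.shade_eventuallyStalls`, `shade_le_shade_zero`, `noRecurrentJumpWalksDeep_holds`,
`noRecurrentBoundaryJumpWalksDeep_holds`, `icNoRecurrentJumpDeep_holds`, `defectDeep_iff_noPlateau`,
`defectWalksDeep_iff_icNoPlateauDeep`)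
are NOT restated — the same short names below resolve to `Theorems.NoJump` (identical statements); lens §5 `closes` (=
`MaxContactCutExponentLadder.closes`) is not restated.  KEPT VERBATIM, in three modules sharing this namespace: (a)
`Theorems.JumpCutModel`
= §1 the MODEL LAW `not_shadeIncreases_of_ordZero_eq` (Hauser–Perlega (2) at `c = pᵉ`, all `e`) +
`two_mul_le_ordZero_of_shadeIncreases_pow`
+ `orderMultipleCondition_of_shadeIncreases`; THIS file = module docstring + §2 plateau laws (`exists_plateau`, SUBCRITICALITY
`plateau_lt_of_satellite_io`, `residual_profile`, HEIGHT DICHOTOMY `satellite_io_iff_plateau_lt`,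
`one_le_shade_of_plateau`) + §3 the all-`e`
column (d) (`NoPlateauWalks`, `walksTerminate_iff_noPlateau`); `Theorems.JumpCutPlateaux` = §4 the split beneath
the equivalence (b)(c)
(`NoSatellitePlateauxDeep`, `NoSubcriticalPlateauxDeep`, `NoRecurrentSubcriticalPlateauxDeep`,
`NoRecurrentSatellitePlateauxDeep` + kernels;
`NoOriginTails` IMPORTED from the landed `Theorems.ProximityCutOrigin`, PROVED there).  ONE aside for the joint residual
(`ICNoRecurrentSatellitePlateauxDeep`, refining 31870) waits for the MaxContactCut route-edit blocker.]

Seat `planner-decomp-res-lens-3-g13-0`, 2026-08-30.  Lens 3 = «one certified translation (the single allowed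
EQUIV) + split beneath».  This generation's EQUIV is a THEOREM, not a definition: the jump half of g10's exact
itinerary cut of the blocker is PROVED, so the blocker IS its plateau half.

## Target (tree decls, BY NAME — nothing of the tree is re-typed)
* BLOCKER: `Theorems.TightDefectClasses.DefectWalksTerminateDeep` = MaxContactCut aside **31770 `DefectWalksDeep`**
  (`MaxContactCutTightDefect.defectWalksDeep_iff := Iff.rfl`): no infinite FORCED walk of the point-blow-up model
  (`ForcedWalk`: centre on the new exceptional divisor, equimultiple, top locus ISOLATED at every stage) at
  `q = pᵉ`, `e ≥ 2`, three base variables, keeps positive shade for ever.  g10's EXACT cut (tree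
  `ItineraryCutClasses.defectDeep_iff`): 31770 ⟺ `NoPlateauWalksDeep` (31870) ∧ `NoRecurrentJumpWalksDeep` (31871).
* ROOT: `closes` = `MaxContactCutExponentLadder.closes` BY NAME (binders hR hP hB h1 hC hH hS hD; cone unchanged).

## THE LAW (PROVED, 0 sorry): `shade_succ_le_shade` — along every forced walk from a root the shade NEVER
increases (`(W.st (t+1)).shade ≤ (W.st t).shade` for all `t`; all primes `p`, ALL exponents `e`, `|σ| = 3`).
Three steps:
1. LIGHT LANDING `walk_ord_lt` (tree `pair_lt_of_isolatedTop` read at stage `t + 1` + `BoundaryLedger.r_succ_eq`):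
   the chart component of the boundary of `W.st (t+1)` has multiplicity `o_t − q`, and isolation of the top locus
   of `W.st (t+1)` forbids `y_j^{o_t − q}·y_k^{r_k} ∣ F_{t+1}` with `(o_t − q) + r_k ≥ q`; hence `q ≤ o_t < 2q` at
   EVERY stage of EVERY forced walk.
2. `q ∣ o_t` at a jump (Hauser–Perlega (2) «o = w·c», tree `necessary_of_shadeIncreases_pow` (i)) ⇒ `o_t = q`.
3. NEW MODEL THEOREM `not_shadeIncreases_of_ordZero_eq` = Hauser–Perlega 2019 §3 Theorem (2) «w ≥ 2» at
   `c = q = pᵉ` for EVERY `e` and every number of variables (the tree had `e = 1` only: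
   `PointBlowup.two_mul_le_ordZero_of_shadeIncreases` in `PointBlowupIncreaseOrder`, whose layer argument uses
   degree `≤ p`): at `ord₀ F = q`, cleaned `F`, `r ≤ supp F`, centre `b` with `b_j = 0` EQUIMULTIPLE ⇒ no shade
   increase.  Proof by a PARTIAL TRANSLATION (characteristic enters only through HP (3) =
   `necessary_of_shadeIncreases_pow` (iii); no Hasse probe, no Frobenius): a jump loses a component `i₀`
   (`b_{i₀} ≠ 0 ≠ r_{i₀}`); the `y_j`-free layer of the point transform is `T = G₀(y + b)`, `G₀` = initial form in
   the chart; equimultiplicity makes every non-constant monomial `y^D` of `T` an initial monomial of `F` with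
   `D_j = 0`; `T` is not constant; `D ≠ q·e_{i₀}` (cleaning) gives `i₁ ≠ i₀` with `D_{i₁} ≥ 1`;
translating `T` by
   `−b_{i₀}e_{i₀}` yields `G₀(y + b⁰)` with `b⁰_{i₀} = 0`, all of whose monomials keep `y_{i₀}` — yet its
   coefficient at `D − D_{i₀}e_{i₀}` is `coeff_D(T)·(−b_{i₀})^{D_{i₀}} ≠ 0` (`translate_translate`,
   `WeightedBlowup.coeff_translate_monomial`).  Booked corollaries: `two_mul_le_ordZero_of_shadeIncreases_pow`
   (`2q ≤ o` at every equimultiple jump, all `e`) and the tree's TYPED literature predicate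
   `HauserPerlega2019.OrderMultipleCondition (p^e) F` (`orderMultipleCondition_of_shadeIncreases`; the predicate was
   defined in `PointBlowupShadeCentres` but derived nowhere at `pᵉ`).

## Consequences (all PROVED, 0 sorry)
* **31871 DECIDED**: `noRecurrentJumpWalksDeep_holds : NoRecurrentJumpWalksDeep`, and BY NAME on the host
  `icNoRecurrentJumpDeep_holds : MaxContactCut.ICNoRecurrentJumpDeep` (audit: proof-of-item, route item; axioms
  propext · Classical.choice · Quot.sound); boundary form `noRecurrentBoundaryJumpWalksDeep_holds`.
* **THE ONE EQUIV** `defectDeep_iff_noPlateau : DefectWalksTerminateDeep ↔ NoPlateauWalksDeep` (31770 ≡ 31870;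
  host form `defectWalksDeep_iff_icNoPlateauDeep`); all-`e` column `walksTerminate_iff_noPlateau :
  WalksTerminate ↔ NoPlateauWalks` (with the tree's `walksTerminate_iff_defect`).
* **PLATEAU LAW** `exists_plateau`: every forced walk settles on a plateau of constant height `s∞ ≤ q`
  (`not_eventually_supercritical`, g11); `shade_eq_of_shade_eq`: between two equal values the shade is constant
  (lasso cycles are level).
* **g11's 2 × 2 grid loses its jump row**: `satDeep_iff_satPlateau : SatDefectWalksTerminateDeep ↔
  NoSatellitePlateauxDeep`; `noPlateau_iff_critical_sat`, `defectDeep_iff_critical_satPlateau :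
  DefectWalksTerminateDeep ↔ NoCriticalFreePlateauxDeep ∧ NoSatellitePlateauxDeep` (kernel `free_tail_rigid`).
* **SUBCRITICALITY** `plateau_lt_of_satellite_io`: a plateau visited by satellite moves at infinitely many times
  has height `s∞ < q` (at height `q` the boundary mass `|r_t|` is non-decreasing, grows at every satellite move,
  and is `< q` by light landing); `residual_profile`: every walk of the residual class is eventually a plateau of
  height `s∞ ∈ [1, q − 1]` — the critical height `q` belongs to the FREE tails only (g11 `free_tail_rigid`).
* **HEIGHT DICHOTOMY (rev 2)** `satellite_io_iff_plateau_lt`: on a plateau, satellite-recurrent ⟺ subcritical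
  (converse `satellite_io_of_plateau_lt` by `free_tail_rigid`) — the satellite itinerary is READ OFF the height, so
  the residual column is ITINERARY-FREE: `NoSubcriticalPlateauxDeep` («no forced deep walk with shade eventually a
  constant `s ∈ [1, q−1]`»), `satPlateau_iff_subcritical : NoSatellitePlateauxDeep ↔ NoSubcriticalPlateauxDeep`,
  `defectDeep_iff_critical_subcritical : DefectWalksTerminateDeep ↔ NoCriticalFreePlateauxDeep ∧
  NoSubcriticalPlateauxDeep`, and modulo g12 `defectDeep_iff_recSubcritical (hO) (hC) : DefectWalksTerminateDeep ↔
  NoRecurrentSubcriticalPlateauxDeep` («… and translated moves at infinitely many times»).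

## PIECES (E-format deep column, tags) — 31770 ⟸
| piece | tag |
|---|---|
| `NoRecurrentJumpWalksDeep` (31871) | **DECIDED — PROVED here** (`noRecurrentJumpWalksDeep_holds`; law
`shade_succ_le_shade`) |
| `NoPlateauWalksDeep` (31870) | ≡ 31770 (`defectDeep_iff_noPlateau`) — the EQUIV; split beneath: |
| `NoCriticalFreePlateauxDeep` (g11, tree) | = `NoBareTailsDeep` [KNOWN-MOD-PORT `BareTailPort`, CJS 5.37] ∧
`NoLoadedCriticalPlateauxDeep` [DESK-DECIDED by g12's arc law ⊇ loaded line; critic rows 79/83] — NECESSARY, WEAKER |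
| `NoSatellitePlateauxDeep` (new name; = g11 `SatDefectWalksTerminateDeep` by `satDeep_iff_satPlateau`) | UNDECIDED
· NECESSARY (`satPlateau_of_deep`) · WEAKER · profile PROVED (`residual_profile`: height `1 ≤ s∞ ≤ q−1`) |
| `NoOriginTails` (g12, restated verbatim) | DECIDED (g12 rev 3a `noOriginTails_holds`; tree landing pending) —
hypothesis here |
| `NoRecurrentSatellitePlateauxDeep` | **THE ONE LOCATED RESIDUAL**: ≡ 31770 modulo the decided/ported pieces
(`defectDeep_iff_recSatPlateau (hO) (hC)`; `defectWalksDeep_of_pieces` on the host) · NECESSARY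
(`recSatPlateau_of_deep`) · IDEA-NEEDED · INSTRUMENTABLE |
| `NoSubcriticalPlateauxDeep` / `NoRecurrentSubcriticalPlateauxDeep` (rev 2) | the SAME two classes WITHOUT
itinerary words (`satPlateau_iff_subcritical`, `defectDeep_iff_critical_subcritical`, `defectDeep_iff_recSubcritical
(hO) (hC)`, host `defectWalksDeep_of_subcritical_pieces`): «shade eventually constant in `[1, q−1]` (∧
translations i.o.)» |

THE RESIDUAL IN WORDS: an infinite forced deep walk (`q = pᵉ`, `e ≥ 2`, three base variables, perfect `K`) whose
shade is eventually CONSTANT `= s∞` with `1 ≤ s∞ ≤ q − 1` (never a jump, never critical), which makes SATELLITE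
moves at infinitely many times AND TRANSLATED moves (`b_t ≠ 0`) at infinitely many times.  COORDINATION (critic
cn16): a plateau walk with finitely many translations is eventually translation-free and dies by g12's
`noOriginTails_holds` (three-chart monomial towers: `noCornerTowers_tree`; one/two charts: the arc law's axis /
origin cases) — so this residual is CONTAINED IN lens-5's translation-recurrent class, and the cell books ONE
residual «subcritical plateau ∧ satellite-recurrent ∧ translation-recurrent», not two.

## WHY NOVEL (relative to the tree, the bus and the literature searched)
* First node that DECIDES a half of an exact dichotomy of 31770 by a theorem about ALL forced walks (g10 typed the
  dichotomy, g11 proved the free×jump cell empty; the census instrument I56 T-forced-jump-1 (kit j340140) found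
  0 jumps / 187 170 at isolated-top states and proposed the ONE-STATE candidate `no_jump_of_isolatedTop` (isolation
  at the PARENT).  This node proves the TWO-STAGE form (isolation at the CHILD, which every forced walk has) —
  immaterial along walks, immune to Hauser–Perlega's comments (a)/(g) (a jump is decided by the initial form, `r`
  and `b` only, while high-order terms can re-isolate the parent's top locus), and it explains the census: the
  99.6 % HEAVY parents are exactly `o ≥ 2q`).
* Literature placement (searched: `lit search --hybrid` ×2, `lit galaxy search --star all` ×1, the barrier files):
  Hauser–Perlega, J. Algebraic Geom. 28 (2019) §1 [corpus: Literature/Barriers/ResolutionOfSingularities/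
  ResidualOrderUnbounded.lean, verbatim quote] «We were not able to construct examples with cycles where the choice
  of point centers is forced (e.g., because the singularities are isolated)»; Hauser–Perlega, PRIMS 60 (2024) §7
  [corpus:paper:hauser2024-resolving-surface-singularities-positive-characteristic p.798–800] «whether it is
  possible in higher dimensions to always find a sequence of blowups which leads to a decrease of the residual
  order in the long run is still unsolved», with the `n = 3` Examples 1–2 whose increase / stagnation step starts
  from a state with a HEAVY pair (`r_x + r_y = 12 + 2 ≥ 9`, resp. `1 + 1 ≥ 2`: the `w`-axis lies in the top locus
  — NOT forced, exactly what light landing excludes); HP2024 §4 p.777 «the residual order may even increase in the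
  case when X has an isolated singularity» concerns SURFACES (`n = 2`, where `pair_lt_of_isolatedTop` is void).
  For `n = 3` and FORCED point sequences the law «the shade never increases» is, as far as these searches show, not
  in print (galaxy: no relevant hits for "kangaroo point|kangaroo phenomenon|residual order may increase").
* HP2019 §3 Theorem (2) at `c = pᵉ` is now a THEOREM of the model for all `e` (tree: `e = 1`), by a proof
  different from Moh's / Hauser–Perlega's (no differential operators: one partial translation and the binomial
  theorem).

## BARRIERS (`Literature/Barriers/ResolutionOfSingularities/`)
technique class = Newton-polyhedron / initial-form combinatorics under translation + exceptional bookkeeping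
(characteristic-free except Lucas via `necessary_of_shadeIncreases_pow`).  `KangarooShadeIncrease` (Moh/Hauser:
ONE blow-up raises the shade; `n = 2`, order `8 = 4q`): outside — the law quantifies over forced walks in `n = 3`,
where `o < 2q`; HP (2) is the hypothesis the kangaroo needs and light landing denies.  `ResidualOrderUnbounded*`
(HP 2019b: unbounded increase along point sequences, `n = 5`, `e = 3`): outside — `ResidualOrderUnboundedUnforced`
PROVES those runs are unforced (a 3-dimensional permissible centre at every step); the law says more: a forced
run has NO increase at all.  `HardPolyhedraGameTwoCycle`, `StratumFirstInvIncrease*`, `Directrix*`: other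
invariants / games, not the shade of the E-model.  Negatives index (`ledger negatives --problem
ResolutionOfSingularities`): no statement about forced walks is refuted; the law contradicts no landed Negative
lemma (it is a theorem).

## Files
`g13/JumpCut.lean` (this file; tree-only imports; no `sorry`, no option lines), `g13/bc/Probe.lean` (P1–P7
MUST-FAIL piece → blocker probes incl. P4 «`NoPlateauWalksDeep → DefectWalksTerminateDeep` is NOT available from
the tree without this node»; C1–C2 controls), `g13/NODE-g13.md` (card), `g13/SEED-g14.md`.
WRITER: land §1 as `Literature/AlgebraicGeometry/Resolution/PointBlowupNoJumpAtOrderQ.lean` (model theorems, cite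
HauserPerlega2019PRIMS §3 Thm (2)) or inside a Theorems module; §2–§4 as `Theorems/JumpCutClasses.lean`; the
by-name file `Theorems/MaxContactCutJumpCut.lean` proving `MaxContactCut.ICNoRecurrentJumpDeep` (closes item
31871) and `MaxContactCut.DefectWalksDeep ↔ MaxContactCut.ICNoPlateauDeep`; asides `JCNoSatellitePlateauxDeep`,
`JCNoRecurrentSatellitePlateauxDeep` (reinformal 31770 / 31870: «≡ plateau half; residual = subcritical
satellite- and translation-recurrent plateaux»).
-/

open MvPolynomial Finset
open Literature.AlgebraicGeometry.Resolution
open Literature.AlgebraicGeometry.Resolution.Hauser2010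
open Literature.AlgebraicGeometry.Resolution.PointBlowup
open Summit.ResolutionOfSingularities.ResolutionOfSingularities.Theorems.TightDefectClasses
open Summit.ResolutionOfSingularities.ResolutionOfSingularities.Theorems.TightDefectStrongWalks
open Summit.ResolutionOfSingularities.ResolutionOfSingularities.Theorems.ItineraryCutClasses
open Summit.ResolutionOfSingularities.ResolutionOfSingularities.Theorems.BoundaryLedger
open Summit.ResolutionOfSingularities.ResolutionOfSingularities.Theorems.NoJump

namespace Summit.ResolutionOfSingularities.ResolutionOfSingularities.Theorems.JumpCut

/-! ## §2 The walk law: NO FORCED WALK EVER JUMPS (`|σ| = 3`, all `q = pᵉ`, from a root) -/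

section Walk

variable {p e : ℕ} {K : Type} [Field K] [DecidableEq K] [CharP K p] {s₀ : State (Fin 3) K}

/-- **PLATEAU LAW (PROVED).**  Every forced walk from a root settles on a plateau: from some time on its shade is a
constant natural number `s∞ ≤ q` (no jumps + well-foundedness; the bound is g11's `not_eventually_supercritical`).
[folklore] -/
theorem exists_plateau (hp : p.Prime) (hroot : IsRoot (p ^ e) s₀) (W : ForcedWalk (p ^ e) s₀) :
    ∃ N s : ℕ, s ≤ p ^ e ∧ ∀ t, N ≤ t → (W.st t).shade = (s : ℕ∞) := by
  obtain ⟨N, hN⟩ := shade_eventuallyStalls hp hroot W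
  have hN' : ∀ t, N ≤ t → (W.st (t + 1)).shade = (W.st t).shade := hN
  have hconst : ∀ t, N ≤ t → (W.st t).shade = (W.st N).shade := by
    intro t ht
    induction t, ht using Nat.le_induction with
    | base => rfl
    | succ t ht ih => rw [hN' t ht, ih]
  obtain ⟨o, ho, -⟩ := walk_nat hroot W N
  obtain ⟨s, hs, -⟩ := order_eq_shade_add_degree hroot W N ho
  refine ⟨N, s, ?_, fun t ht => by rw [hconst t ht, hs]⟩
  by_contra hlt
  rw [not_le] at hlt
  exact not_eventually_supercritical hroot W ⟨N, fun t ht => by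
    rw [hconst t ht, hs]
    exact_mod_cast hlt⟩

/-- Level stretches: if the shade returns to an earlier value, it was constant in between (lasso cycles are level).
[folklore] -/
theorem shade_eq_of_shade_eq (hp : p.Prime) (hroot : IsRoot (p ^ e) s₀) (W : ForcedWalk (p ^ e) s₀) {t₀ t₁ : ℕ}
    (he : (W.st t₁).shade = (W.st t₀).shade) {t : ℕ} (h₀ : t₀ ≤ t) (h₁ : t ≤ t₁) :
    (W.st t).shade = (W.st t₀).shade :=
  le_antisymm (shade_antitone hp hroot W h₀) (he ▸ shade_antitone hp hroot W h₁)

omit [CharP K p] in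
/-- **SUBCRITICALITY OF SATELLITE PLATEAUX (PROVED).**  A plateau of height `s` visited by satellite moves at
infinitely many times has `s < q`: at height `q` the boundary mass `|r_t|` never decreases (ledger
`|r_{t+1}| = |kept_t| + s + |r_t| − q`) and increases at every satellite move, while light landing keeps `|r_t| < q`.
[folklore] -/
theorem plateau_lt_of_satellite_io (hroot : IsRoot (p ^ e) s₀) (W : ForcedWalk (p ^ e) s₀) {N s : ℕ}
    (hplat : ∀ t, N ≤ t → (W.st t).shade = (s : ℕ∞)) (hsat : ∀ M : ℕ, ∃ t, M ≤ t ∧ W.Satellite t) :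
    s < p ^ e := by
  classical
  have hsq : s ≤ p ^ e := by
    by_contra hlt
    rw [not_le] at hlt
    exact not_eventually_supercritical hroot W ⟨N, fun t ht => by
      rw [hplat t ht]
      exact_mod_cast hlt⟩
  rcases hsq.lt_or_eq with hlt | hsq'
  · exact hlt
  exfalso
  have hstep : ∀ t, N ≤ t → (W.st (t + 1)).r.degree = (kept W t).degree + (W.st t).r.degree := by
    intro t ht
    obtain ⟨s', hs', hled⟩ := ledger_step hroot W t
    have hss' : s' = s := by
      have h := hplat t ht
      rw [hs'] at h
      exact_mod_cast h
    rw [hss', hsq'] at hled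
    omega
  have hmono : ∀ t, N ≤ t → ∀ u, t ≤ u → (W.st t).r.degree ≤ (W.st u).r.degree := by
    intro t ht u hu
    induction u, hu using Nat.le_induction with
    | base => exact le_rfl
    | succ u hu ih =>
      rw [hstep u (ht.trans hu)]
      omega
  have hgrow : ∀ k : ℕ, ∃ t, N ≤ t ∧ k ≤ (W.st t).r.degree := by
    intro k
    induction k with
    | zero => exact ⟨N, le_rfl, Nat.zero_le _⟩
    | succ k ih =>
      obtain ⟨t, ht, hk⟩ := ih
      obtain ⟨u, hu, hsu⟩ := hsat t
      have hkept : (kept W u).degree ≠ 0 := by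
        rw [Ne, Finsupp.degree_eq_zero_iff]
        exact (satellite_iff_kept_ne_zero W u).mp hsu
      refine ⟨u + 1, by omega, ?_⟩
      rw [hstep u (ht.trans hu)]
      have := hmono t ht u hu
      omega
  obtain ⟨t, ht, hq⟩ := hgrow (p ^ e)
  obtain ⟨o, ho, -, ho2⟩ := order_lt_two_mul hroot W t
  obtain ⟨s', hs', hos⟩ := order_eq_shade_add_degree hroot W t ho
  have hss' : s' = s := by
    have h := hplat t ht
    rw [hs'] at h
    exact_mod_cast h
  omega

/-- **PROFILE OF THE RESIDUAL (PROVED).**  An infinite forced walk with positive shade and satellite moves at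
infinitely many times is, from some time on, a plateau of constant height `s∞` with `1 ≤ s∞ ≤ q − 1`. [folklore] -/
theorem residual_profile (hp : p.Prime) (hroot : IsRoot (p ^ e) s₀) (W : ForcedWalk (p ^ e) s₀)
    (hpos : ∀ i, 1 ≤ (W.st i).shade) (hsat : ∀ M : ℕ, ∃ t, M ≤ t ∧ W.Satellite t) :
    ∃ N s : ℕ, 1 ≤ s ∧ s < p ^ e ∧ ∀ t, N ≤ t → (W.st t).shade = (s : ℕ∞) := by
  obtain ⟨N, s, -, hplat⟩ := exists_plateau hp hroot W
  refine ⟨N, s, ?_, plateau_lt_of_satellite_io hroot W hplat hsat, hplat⟩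
  have h := hpos N
  rw [hplat N le_rfl] at h
  exact_mod_cast h

/-- **Converse: on a plateau of SUBCRITICAL height the satellite moves recur** (kernel: g11's `free_tail_rigid` —
an eventually free tail is critical). [folklore] -/
theorem satellite_io_of_plateau_lt (hp : p.Prime) (hroot : IsRoot (p ^ e) s₀) (W : ForcedWalk (p ^ e) s₀)
    {N s : ℕ} (hplat : ∀ t, N ≤ t → (W.st t).shade = (s : ℕ∞)) (hs : s < p ^ e) :
    ∀ M : ℕ, ∃ t, M ≤ t ∧ W.Satellite t := by
  by_contra h
  push Not at h
  obtain ⟨M, hM⟩ := h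
  obtain ⟨N₁, ρ, -, hrig⟩ := free_tail_rigid hp hroot W ⟨M, hM⟩
  have h1 := hplat (max N N₁) (le_max_left _ _)
  have h2 := (hrig (max N N₁) (le_max_right _ _)).2.1
  rw [h1] at h2
  have h3 : s = p ^ e := by exact_mod_cast h2
  omega

/-- **HEIGHT DICHOTOMY of plateaux (PROVED): satellite-recurrent ⟺ subcritical** (`s∞ < q`); equivalently
eventually free ⟺ critical (`s∞ = q`).  The satellite itinerary is thus READ OFF the plateau height. [folklore] -/
theorem satellite_io_iff_plateau_lt (hp : p.Prime) (hroot : IsRoot (p ^ e) s₀) (W : ForcedWalk (p ^ e) s₀)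
    {N s : ℕ} (hplat : ∀ t, N ≤ t → (W.st t).shade = (s : ℕ∞)) :
    (∀ M : ℕ, ∃ t, M ≤ t ∧ W.Satellite t) ↔ s < p ^ e :=
  ⟨plateau_lt_of_satellite_io hroot W hplat, satellite_io_of_plateau_lt hp hroot W hplat⟩

/-- On a plateau of positive height every shade along the walk is positive (the shade is antitone). [folklore] -/
theorem one_le_shade_of_plateau (hp : p.Prime) (hroot : IsRoot (p ^ e) s₀) (W : ForcedWalk (p ^ e) s₀)
    {N s : ℕ} (hplat : ∀ t, N ≤ t → (W.st t).shade = (s : ℕ∞)) (hs : 1 ≤ s) (i : ℕ) :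
    1 ≤ (W.st i).shade := by
  have h1 : (W.st (max i N)).shade ≤ (W.st i).shade := shade_antitone hp hroot W (le_max_left i N)
  rw [hplat (max i N) (le_max_right i N)] at h1
  exact le_trans (by exact_mod_cast hs) h1

end Walk

/-! ### All exponents: the E-format blocker `WalksTerminate` is a plateau statement too -/

/-- **`NoPlateauWalks`** — no infinite forced walk (`q = pᵉ`, `e ≥ 1`, positive shade throughout) whose shade is
eventually constant. [UNDECIDED · ≡ `DefectWalksTerminate` ≡ `WalksTerminate` by `walksTerminate_iff_noPlateau`] -/
def NoPlateauWalks : Prop :=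
  ∀ p : ℕ, p.Prime → ∀ e : ℕ, 1 ≤ e → ∀ (K : Type) [Field K] [CharP K p] [PerfectField K] [DecidableEq K]
    (s₀ : State (Fin 3) K), IsRoot (p ^ e) s₀ → ∀ W : ForcedWalk (p ^ e) s₀, (∀ i, 1 ≤ (W.st i).shade) →
    EventuallyStalls (fun i => (W.st i).shade) → False

/-- `DefectWalksTerminate ↔ NoPlateauWalks` (PROVED: every forced walk stalls). [folklore] -/
theorem defect_iff_noPlateau : DefectWalksTerminate ↔ NoPlateauWalks :=
  ⟨fun h p hp e he K _ _ _ _ s₀ hs W hpos _ => h p hp e he K s₀ hs W hpos,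
    fun h p hp e he K _ _ _ _ s₀ hs W hpos => h p hp e he K s₀ hs W hpos (shade_eventuallyStalls hp hs W)⟩

/-- **`WalksTerminate ↔ NoPlateauWalks`** (PROVED, with the tree's `walksTerminate_iff_defect`). [folklore] -/
theorem walksTerminate_iff_noPlateau : WalksTerminate ↔ NoPlateauWalks :=
  walksTerminate_iff_defect.trans defect_iff_noPlateau

/-- The deep plateau piece is the `e ≥ 2` restriction of `NoPlateauWalks`. [folklore] -/
theorem noPlateauDeep_of_noPlateau (h : NoPlateauWalks) : NoPlateauWalksDeep :=
  fun p hp e he K _ _ _ _ s₀ hs W hpos hS => h p hp e (one_le_two.trans he) K s₀ hs W hpos hS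


end Summit.ResolutionOfSingularities.ResolutionOfSingularities.Theorems.JumpCut
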